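import Summits.CriticalPhenomena.Ising3DConformalLimit.Theorems.ExistsScaleCovariantLimit.Negative.DyadicIdentity
import Summits.CriticalPhenomena.Ising3DConformalLimit.Theorems.ExistsScaleCovariantLimit.Negative.DyadicTwoPrimesDensity
import Mathlib.Topology.UniformSpace.UniformApproximation
import Mathlib.Algebra.Group.Subgroup.Lattice
import HarnessLib

/-!
# Two hierarchies force the triadic identity
(line `Sketch` of the crux `ExistsScaleCovariantLimit`, item stmt-CriticalPhenomena-1981;
stub `stub_twoHierarchies`)

The pinned zoom `pz n δ x := rescaledCorrelator (criticalCorr 3) rhoPin n δ x` of the critical `ℤ³`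
Ising correlators is an EXACT orbit of the dilation group: for `s, δ > 0`,
`pz n (δ/s) x = pz₂(δ)(0, s e₀)^{-n/2} · pz n δ (s·x)` (`Dyadic.pz_scale`). Suppose the zoom converges
along the dyadic meshes `2^{-k}` to `S` (all `n`, locally uniformly off the diagonals), `S` is continuous
off the diagonals, and the zoom converges POINTWISE along the triadic meshes `3^{-k}` to some a priori
unrelated `S'`. Writing `3^{-k} = 2^{-j}/σ` with `σ = 3^k 2^{-j}`, the triadic zoom at `x` is the re-pinned
dyadic zoom at the moving configuration `σ·x`; since `{k log 3 − j log 2 : k ≥ K, j ∈ ℕ}` is dense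
(density of `ℤ log 2 + ℤ log 3`, `dense_closure_log_two_log_three`, plus a semigroup/sign refinement,
`exists_seq_three_two_tendsto`), every `s > 0` is a limit of such `σ` along `k → ∞`, and continuity of `S`
gives `S' n x = S₂(0,se₀)^{-n/2} S n (s·x)` for all `s ∈ (0, 2]` (`triadicLimit_eq`). At `s = 1` this forces
`S' = S`; the identities at `s = 3/2` and `s = 2` compose to the single triadic self-consistency
`S n x = S₂(0,3e₀)^{-n/2} S n (3·x)` (`stub_twoHierarchies`), using `S₂(0,3e₀) = S₂(0,(3/2)e₀)·S₂(0,2e₀)`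
and `S₂(0,2e₀) > 0` (`dyadicLimit_cfg0_two_pos`: `S₂(0,2e₀) S₂(0,e₀/2) = 1`).

Contents: the arithmetic (`exists_small_step`, `exists_nat_near`, `exists_seq_three_two_tendsto`), the
axis values of a dyadic limit (`dyadicLimit_cfg01`, `dyadicLimit_cfg0_two_pos`, `dyadicLimit_cfg0_pos`),
the transfer identity (`triadicLimit_eq`) and the stub. Pure consequence of landed tree lemmas
(`Negative/DyadicIdentity`, `Negative/DyadicTwoPrimesDensity`); no named facts. [folklore]
-/

noncomputable section
namespace Summit.CriticalPhenomena.Ising3DConformalLimit.Cruxes.ExistsScaleCovariantLimit.TwoHierarchies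
open Literature.Probability.LatticeModels Filter Set
open scoped Topology
open Summit.CriticalPhenomena.Ising3DConformalLimit.MoebiusLimitExistsOnlyInteraction (rhoPin)

open Summit.CriticalPhenomena.Ising3DConformalLimit.ExistsScaleCovariantLimitNegative.Dyadic
open Summit.CriticalPhenomena.Ising3DConformalLimit.PinnedClusterPoints (cfg01_mem rescaled_pin_cfg01)
open Summit.CriticalPhenomena.Ising3DConformalLimit.OnlyInteractionTightness
  (tendstoLocallyUniformlyOn_comp_tendsto)

local notation3 (prettyPrint := false) "cfg0[" s "]" =>
  (![0, EuclideanSpace.single 0 s] : Fin 2 → EuclideanSpace ℝ (Fin 3))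
local notation3 (prettyPrint := false) "pz" => rescaledCorrelator (criticalCorr 3) rhoPin

/-! ### Arithmetic: `3^k 2^{-j}` with natural exponents, `k → ∞`, approximates every `s > 0` -/

/-- Arbitrarily small POSITIVE combinations `b·log 3 − a·log 2` with NATURAL `a, b`: density of
`ℤ log 2 + ℤ log 3` and a sign correction (`log 2 − M·u` for a small positive `u` of the wrong
sign). [folklore] -/
private theorem exists_small_step {ε : ℝ} (hε : 0 < ε) :
    ∃ a b : ℕ, 0 < (b:ℝ) * Real.log 3 - a * Real.log 2 ∧ (b:ℝ) * Real.log 3 - a * Real.log 2 < ε := by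
  have hl2 : 0 < Real.log 2 := Real.log_pos one_lt_two
  have hl3 : 0 < Real.log 3 := Real.log_pos (by norm_num)
  have hl23 : Real.log 2 < Real.log 3 := Real.log_lt_log two_pos (by norm_num)
  set ε' : ℝ := min ε (Real.log 2) with hε'
  have hε'0 : 0 < ε' := lt_min hε hl2
  have hε'1 : ε' ≤ ε := min_le_left _ _
  have hε'2 : ε' ≤ Real.log 2 := min_le_right _ _
  -- integer version with a positive `log 3`-coefficient
  obtain ⟨a, b, hb, hpos, hlt⟩ : ∃ a b : ℤ, 0 < b ∧ 0 < (b:ℝ) * Real.log 3 - a * Real.log 2 ∧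
      (b:ℝ) * Real.log 3 - a * Real.log 2 < ε' := by
    obtain ⟨h₀, hH, h0, h1⟩ := dense_closure_log_two_log_three.exists_between hε'0
    obtain ⟨m, n, hmn⟩ := AddSubgroup.mem_closure_pair.1 hH
    simp only [zsmul_eq_mul] at hmn
    rcases lt_trichotomy 0 n with hn | hn | hn
    · refine ⟨-m, n, hn, ?_, ?_⟩ <;> push_cast <;> linarith
    · exfalso
      subst hn
      simp only [Int.cast_zero, zero_mul, add_zero] at hmn
      have hm : (0:ℝ) < m := by
        by_contra hcon
        push Not at hcon
        have : (m:ℝ) * Real.log 2 ≤ 0 := mul_nonpos_of_nonpos_of_nonneg hcon hl2.le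
        linarith
      have hm1 : (1:ℝ) ≤ m := by
        have hm' : (0:ℤ) < m := by exact_mod_cast hm
        exact_mod_cast (show (1:ℤ) ≤ m by omega)
      have : Real.log 2 ≤ (m:ℝ) * Real.log 2 := le_mul_of_one_le_left hl2.le hm1
      linarith
    · -- `n < 0`: sign correction
      have hq : 0 < Real.log 2 / h₀ := div_pos hl2 h0
      have hc0 : ⌈Real.log 2 / h₀⌉₊ ≠ 0 := (Nat.ceil_pos.2 hq).ne'
      obtain ⟨M, hM⟩ := Nat.exists_eq_add_one_of_ne_zero hc0
      have hM1 : (M:ℝ) * h₀ < Real.log 2 := by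
        have hc1 := Nat.ceil_lt_add_one hq.le
        rw [hM] at hc1
        push_cast at hc1
        exact (lt_div_iff₀ h0).1 (by linarith)
      have hM2 : Real.log 2 ≤ (M:ℝ) * h₀ + h₀ := by
        have hc2 := Nat.le_ceil (Real.log 2 / h₀)
        rw [hM] at hc2
        push_cast at hc2
        have h := (div_le_iff₀ h0).1 hc2
        linarith
      have hM0 : 0 < M := by
        rcases Nat.eq_zero_or_pos M with hM0 | hM0
        · exfalso
          subst hM0
          norm_num at hM2
          linarith
        · exact hM0
      have hM0' : (0:ℤ) < (M:ℤ) := by exact_mod_cast hM0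
      refine ⟨(M:ℤ) * m - 1, -((M:ℤ) * n), ?_, ?_, ?_⟩
      · have : (M:ℤ) * n < 0 := mul_neg_of_pos_of_neg hM0' hn
        linarith
      · push_cast
        have e : (M:ℝ) * (m * Real.log 2 + n * Real.log 3) = M * h₀ := by rw [hmn]
        linarith
      · push_cast
        have e : (M:ℝ) * (m * Real.log 2 + n * Real.log 3) = M * h₀ := by rw [hmn]
        linarith
  -- both coefficients are natural numbers
  have ha : 0 ≤ a := by
    by_contra hcon
    push Not at hcon
    have ha' : (a:ℝ) ≤ -1 := by exact_mod_cast (show a ≤ -1 by omega)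
    have hb' : (1:ℝ) ≤ b := by exact_mod_cast (show (1:ℤ) ≤ b by omega)
    have hb3 : Real.log 3 ≤ (b:ℝ) * Real.log 3 := le_mul_of_one_le_left hl3.le hb'
    have ha2 : (a:ℝ) * Real.log 2 ≤ (-1) * Real.log 2 := mul_le_mul_of_nonneg_right ha' hl2.le
    linarith
  obtain ⟨a', rfl⟩ := Int.eq_ofNat_of_zero_le ha
  obtain ⟨b', rfl⟩ := Int.eq_ofNat_of_zero_le hb.le
  exact ⟨a', b', by exact_mod_cast hpos, by exact_mod_cast hlt.trans_le hε'1⟩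

/-- Semigroup refinement of the density of `{2^a 3^b}`: for `s > 0`, `ε > 0` and every `K`, some
`k log 3 − j log 2` with NATURAL `k ≥ K` and `j` is within `ε` of `log s`. [folklore] -/
private theorem exists_nat_near {s ε : ℝ} (hs : 0 < s) (hε : 0 < ε) (K : ℕ) :
    ∃ k j : ℕ, K ≤ k ∧ |(k:ℝ) * Real.log 3 - j * Real.log 2 - Real.log s| < ε := by
  have hl2 : 0 < Real.log 2 := Real.log_pos one_lt_two
  have _hs := hs
  obtain ⟨a, b, hpos, hlt⟩ := exists_small_step hε
  set h : ℝ := (b:ℝ) * Real.log 3 - a * Real.log 2 with hh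
  set j₀ : ℕ := ⌈((K:ℝ) * Real.log 3 - Real.log s) / Real.log 2⌉₊ with hj₀
  set x₀ : ℝ := (K:ℝ) * Real.log 3 - j₀ * Real.log 2 with hx₀
  have hx₀s : x₀ ≤ Real.log s := by
    have h1 : ((K:ℝ) * Real.log 3 - Real.log s) / Real.log 2 ≤ j₀ := Nat.le_ceil _
    rw [div_le_iff₀ hl2] at h1
    rw [hx₀]
    linarith
  set N : ℕ := ⌊(Real.log s - x₀) / h⌋₊ with hN
  have hN1 : (N:ℝ) * h ≤ Real.log s - x₀ := by
    have h1 : (N:ℝ) ≤ (Real.log s - x₀) / h := Nat.floor_le (div_nonneg (by linarith) hpos.le)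
    rwa [le_div_iff₀ hpos] at h1
  have hN2 : Real.log s - x₀ < (N:ℝ) * h + h := by
    have h1 : (Real.log s - x₀) / h < (N:ℝ) + 1 := Nat.lt_floor_add_one _
    rw [div_lt_iff₀ hpos] at h1
    linarith
  refine ⟨K + N * b, j₀ + N * a, Nat.le_add_right _ _, ?_⟩
  have e : ((K + N * b : ℕ) : ℝ) * Real.log 3 - ((j₀ + N * a : ℕ) : ℝ) * Real.log 2 - Real.log s =
      x₀ + N * h - Real.log s := by
    push_cast
    rw [hx₀, hh]
    ring
  rw [e, abs_lt]
  constructor <;> linarith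

/-- For every `s > 0` there are natural sequences `k i → ∞`, `j i → ∞` with `3^{k i} / 2^{j i} → s`
(`log 3 / log 2` is irrational: two incommensurable hierarchies). [folklore] -/
private theorem exists_seq_three_two_tendsto {s : ℝ} (hs : 0 < s) :
    ∃ k j : ℕ → ℕ, Tendsto k atTop atTop ∧ Tendsto j atTop atTop ∧
      Tendsto (fun i => (3:ℝ) ^ (k i) / (2:ℝ) ^ (j i)) atTop (𝓝 s) := by
  have hl2 : 0 < Real.log 2 := Real.log_pos one_lt_two
  have hl3 : 0 < Real.log 3 := Real.log_pos (by norm_num)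
  have H : ∀ i : ℕ, ∃ k j : ℕ, i ≤ k ∧
      |(k:ℝ) * Real.log 3 - j * Real.log 2 - Real.log s| < 1 / ((i:ℝ) + 1) :=
    fun i => exists_nat_near hs Nat.one_div_pos_of_nat i
  choose k j hk hkj using H
  have hkt : Tendsto k atTop atTop := tendsto_atTop_mono hk tendsto_id
  have hlog : Tendsto (fun i => (k i:ℝ) * Real.log 3 - j i * Real.log 2) atTop (𝓝 (Real.log s)) := by
    rw [tendsto_iff_dist_tendsto_zero]
    refine squeeze_zero (fun i => dist_nonneg) (fun i => ?_) tendsto_one_div_add_atTop_nhds_zero_nat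
    rw [Real.dist_eq]
    exact (hkj i).le
  refine ⟨k, j, hkt, ?_, ?_⟩
  · -- `j i → ∞`: `j log 2 > k log 3 - log s - 1`
    have h1 : Tendsto (fun i => (k i:ℝ) * Real.log 3) atTop atTop :=
      (tendsto_natCast_atTop_atTop.comp hkt).atTop_mul_const hl3
    rw [tendsto_atTop_atTop]
    intro b
    obtain ⟨i₀, hi₀⟩ := tendsto_atTop_atTop.1 h1 ((b:ℝ) * Real.log 2 + Real.log s + 1)
    refine ⟨i₀, fun i hi => ?_⟩
    have h2 := hi₀ i hi
    have h3 := (abs_lt.1 (hkj i)).2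
    have h4 : 1 / ((i:ℝ) + 1) ≤ 1 := by
      rw [div_le_one (by positivity)]
      linarith [(Nat.cast_nonneg i : (0:ℝ) ≤ i)]
    have h5 : (b:ℝ) * Real.log 2 < (j i:ℝ) * Real.log 2 := by linarith
    have h6 : (b:ℝ) < j i := lt_of_mul_lt_mul_right h5 hl2.le
    exact (by exact_mod_cast h6 : b < j i).le
  · have hexp := (Real.continuous_exp.tendsto _).comp hlog
    rw [Real.exp_log hs] at hexp
    refine hexp.congr fun i => ?_
    show Real.exp ((k i:ℝ) * Real.log 3 - j i * Real.log 2) = _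
    rw [Real.exp_sub, Real.exp_nat_mul, Real.exp_nat_mul, Real.exp_log two_pos,
      Real.exp_log (by norm_num : (0:ℝ) < 3)]

/-! ### Axis values of a dyadic limit of the pinned zoom -/

/-- Dilating the axis pair: `c • (0, s e₀) = (0, (c s) e₀)`. [folklore] -/
private theorem cfg0_smul (c s : ℝ) : (fun i => c • cfg0[s] i) = cfg0[c * s] := by
  have h := smul_cfg01 (c * s)
  rw [← h, ← smul_cfg01 s]
  funext i
  simp [mul_smul]

/-- Exact pinning passes to the limit: `S₂(0,e₀) = 1` for every dyadic limit `S` of the pinned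
zoom. [folklore] -/
theorem dyadicLimit_cfg01 {S : CorrFamily 3}
    (hdy : ∀ n : ℕ, TendstoLocallyUniformlyOn (fun k : ℕ => pz n (((2:ℝ) ^ k)⁻¹)) (S n) atTop
      (NonCoincident 3 n)) :
    S 2 cfg0[(1:ℝ)] = 1 := by
  have h := (hdy 2).tendsto_at cfg01_mem
  have h' : Tendsto (fun _ : ℕ => (1:ℝ)) atTop (𝓝 (S 2 cfg0[(1:ℝ)])) :=
    h.congr fun k => rescaled_pin_cfg01 _
  exact (tendsto_nhds_unique tendsto_const_nhds h').symm

/-- Any dyadic limit of the pinned zoom has `S₂(0, 2e₀) > 0`; indeed `S₂(0,2e₀)·S₂(0,e₀/2) = 1`,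
because the zoom at mesh `2^{-(k+1)}` at `(0, e₀/2)` is the re-pinned zoom at mesh `2^{-k}` at
`(0, e₀)`, which is `1` (adapted from the standing disprover's `dyadicLimit_two_cfg0_two_pos`).
[folklore] -/
theorem dyadicLimit_cfg0_two_pos {S : CorrFamily 3}
    (hdy : ∀ n : ℕ, TendstoLocallyUniformlyOn (fun k : ℕ => pz n (((2:ℝ) ^ k)⁻¹)) (S n) atTop
      (NonCoincident 3 n)) :
    0 < S 2 cfg0[(2:ℝ)] := by
  have hhalf : cfg0[(1/2:ℝ)] ∈ NonCoincident 3 2 := cfg0_mem (by norm_num)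
  have ha : Tendsto (fun k : ℕ => pz 2 (((2:ℝ) ^ k)⁻¹) cfg0[(2:ℝ)]) atTop (𝓝 (S 2 cfg0[(2:ℝ)])) :=
    (hdy 2).tendsto_at (cfg0_mem two_ne_zero)
  have hb : Tendsto (fun k : ℕ => pz 2 (((2:ℝ) ^ (k + 1))⁻¹) cfg0[(1/2:ℝ)]) atTop
      (𝓝 (S 2 cfg0[(1/2:ℝ)])) :=
    ((hdy 2).tendsto_at hhalf).comp (tendsto_add_atTop_nat 1)
  have hid : ∀ k : ℕ, pz 2 (((2:ℝ) ^ k)⁻¹) cfg0[(2:ℝ)] * pz 2 (((2:ℝ) ^ (k + 1))⁻¹) cfg0[(1/2:ℝ)]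
      = 1 := by
    intro k
    have h := pz_scale (s := 2) two_pos (dyad_pos k) 2 cfg0[(1/2:ℝ)]
    have e : (2:ℝ)⁻¹ * ((2:ℝ) ^ k)⁻¹ = ((2:ℝ) ^ (k + 1))⁻¹ := by rw [pow_succ, mul_inv, mul_comm]
    rw [e, cfg0_smul, show (2:ℝ) * (1/2) = 1 by norm_num, rescaled_pin_cfg01, mul_one] at h
    rw [h]
    have hp := pz_two_cfg0_pos (((2:ℝ) ^ k)⁻¹) 2
    rw [show (-((2:ℕ):ℝ) / 2) = -1 by norm_num, Real.rpow_neg_one, mul_inv_cancel₀ hp.ne']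
  have hprod : S 2 cfg0[(2:ℝ)] * S 2 cfg0[(1/2:ℝ)] = 1 :=
    tendsto_nhds_unique (ha.mul hb) (tendsto_const_nhds.congr fun k => (hid k).symm)
  have hnn : 0 ≤ S 2 cfg0[(2:ℝ)] := ge_of_tendsto' ha fun k => (pz_two_cfg0_pos _ _).le
  rcases hnn.eq_or_lt with h0 | hpos
  · rw [← h0, zero_mul] at hprod
    exact absurd hprod zero_ne_one
  · exact hpos

/-- Monotonicity along the axis passes to the limit: `S₂(0, s e₀) ≥ S₂(0, 2e₀) > 0` for
`0 < s ≤ 2`. [folklore] -/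
theorem dyadicLimit_cfg0_pos {S : CorrFamily 3}
    (hdy : ∀ n : ℕ, TendstoLocallyUniformlyOn (fun k : ℕ => pz n (((2:ℝ) ^ k)⁻¹)) (S n) atTop
      (NonCoincident 3 n)) {s : ℝ} (hs : 0 < s) (hs2 : s ≤ 2) :
    0 < S 2 cfg0[s] := by
  have ha : Tendsto (fun k : ℕ => pz 2 (((2:ℝ) ^ k)⁻¹) cfg0[(2:ℝ)]) atTop (𝓝 (S 2 cfg0[(2:ℝ)])) :=
    (hdy 2).tendsto_at (cfg0_mem two_ne_zero)
  have hb : Tendsto (fun k : ℕ => pz 2 (((2:ℝ) ^ k)⁻¹) cfg0[s]) atTop (𝓝 (S 2 cfg0[s])) :=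
    (hdy 2).tendsto_at (cfg0_mem hs.ne')
  exact (dyadicLimit_cfg0_two_pos hdy).trans_le
    (le_of_tendsto_of_tendsto' ha hb fun k => pz_two_cfg0_anti (dyad_pos k) hs.le hs2)

/-! ### The transfer identity: the triadic limit is the re-dilated dyadic limit -/

/-- **Transfer.** If the pinned zoom converges along `2^{-k}` to `S` (locally uniformly off the
diagonals), `S` is continuous off the diagonals, the zoom converges pointwise along `3^{-k}` to `S'`,
and `S₂(0, s e₀) ≠ 0`, then `S' n x = S₂(0, s e₀)^{-n/2} · S n (s·x)` off the diagonals: write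
`3^{-k_i} = 2^{-j_i}/σ_i` with `σ_i = 3^{k_i}2^{-j_i} → s`, `k_i, j_i → ∞`, apply the exact scale
identity `pz_scale` and pass to the limit along the moving configurations `σ_i·x → s·x`. [folklore] -/
theorem triadicLimit_eq {S S' : CorrFamily 3}
    (hdy : ∀ n : ℕ, TendstoLocallyUniformlyOn (fun k : ℕ => pz n (((2:ℝ) ^ k)⁻¹)) (S n) atTop
      (NonCoincident 3 n))
    (hcont : ∀ n : ℕ, ContinuousOn (S n) (NonCoincident 3 n))
    (htri : ∀ n : ℕ, ∀ x ∈ NonCoincident 3 n,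
      Tendsto (fun k : ℕ => pz n (((3:ℝ) ^ k)⁻¹) x) atTop (𝓝 (S' n x)))
    {s : ℝ} (hs : 0 < s) (hA : S 2 cfg0[s] ≠ 0) (n : ℕ) {x : Fin n → EuclideanSpace ℝ (Fin 3)}
    (hx : x ∈ NonCoincident 3 n) :
    S' n x = (S 2 cfg0[s]) ^ (-(n:ℝ) / 2) * S n (fun i => s • x i) := by
  obtain ⟨k, j, hk, hj, hσ⟩ := exists_seq_three_two_tendsto hs
  have hσpos : ∀ i, 0 < (3:ℝ) ^ (k i) / (2:ℝ) ^ (j i) := fun i => by positivity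
  -- the dyadic zoom along `j i` at moving dilates converges, by continuity of `S`
  have hmove : ∀ (m : ℕ) (y : Fin m → EuclideanSpace ℝ (Fin 3)), y ∈ NonCoincident 3 m →
      Tendsto (fun i => pz m (((2:ℝ) ^ (j i))⁻¹) (fun l => ((3:ℝ) ^ (k i) / (2:ℝ) ^ (j i)) • y l))
        atTop (𝓝 (S m (fun l => s • y l))) := by
    intro m y hy
    have hsy : (fun l => s • y l) ∈ NonCoincident 3 m := smul_mem_nonCoincident hs.ne' hy
    refine (tendstoLocallyUniformlyOn_comp_tendsto (hdy m) hj).tendsto_comp (hcont m _ hsy) hsy ?_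
    exact tendsto_nhdsWithin_iff.2 ⟨tendsto_pi_nhds.2 fun l => hσ.smul tendsto_const_nhds,
      Eventually.of_forall fun i => smul_mem_nonCoincident (hσpos i).ne' hy⟩
  have hR1 : Tendsto (fun i => pz 2 (((2:ℝ) ^ (j i))⁻¹) cfg0[(3:ℝ) ^ (k i) / (2:ℝ) ^ (j i)]) atTop
      (𝓝 (S 2 cfg0[s])) := by
    have h := hmove 2 _ cfg01_mem
    simp only [smul_cfg01] at h
    exact h
  have hR : Tendsto (fun i => (pz 2 (((2:ℝ) ^ (j i))⁻¹) cfg0[(3:ℝ) ^ (k i) / (2:ℝ) ^ (j i)])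
      ^ (-(n:ℝ) / 2) * pz n (((2:ℝ) ^ (j i))⁻¹) (fun l => ((3:ℝ) ^ (k i) / (2:ℝ) ^ (j i)) • x l))
      atTop (𝓝 ((S 2 cfg0[s]) ^ (-(n:ℝ) / 2) * S n (fun l => s • x l))) :=
    (hR1.rpow_const (Or.inl hA)).mul (hmove n x hx)
  have hL : Tendsto (fun i => pz n (((3:ℝ) ^ (k i))⁻¹) x) atTop (𝓝 (S' n x)) := (htri n x hx).comp hk
  refine tendsto_nhds_unique (hL.congr fun i => ?_) hR
  -- the exact identity at step `i`
  have e : ((3:ℝ) ^ (k i) / (2:ℝ) ^ (j i))⁻¹ * ((2:ℝ) ^ (j i))⁻¹ = ((3:ℝ) ^ (k i))⁻¹ := by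
    rw [inv_div, div_mul_eq_mul_div, mul_inv_cancel₀ (by positivity), one_div]
  show pz n (((3:ℝ) ^ (k i))⁻¹) x = _
  rw [← e]
  exact pz_scale (hσpos i) (dyad_pos (j i)) n x

/-! ### The stub -/

/-- **Glue — two hierarchies force the triadic identity.** If the pinned zoom of the critical `ℤ³`
Ising correlators converges along `2^{-k}` to `S` (all `n`, locally uniformly off the diagonals), `S`
is continuous off the diagonals, and the pinned zoom converges along `3^{-k}` POINTWISE off the
diagonals to some `S'`, then `S` is self-consistent under the dilation `3`:
`S n x = S₂(0,3e₀)^{-n/2} · S n (3·x)`. By the transfer identity `triadicLimit_eq`,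
`S' n x = S₂(0,se₀)^{-n/2} S n (s·x)` for `s = 1, 3/2, 2` (`S₂(0,se₀) > 0` there by
`dyadicLimit_cfg0_pos`); `s = 1` gives `S' = S`, and the identities at `s = 3/2` (at `x` and at the
axis pair `(0,2e₀)`) and `s = 2` (at `(3/2)·x`) compose, with
`S₂(0,3e₀) = S₂(0,(3/2)e₀)·S₂(0,2e₀)`. [folklore] -/
theorem stub_twoHierarchies : ∀ S S' : CorrFamily 3, (∀ n : ℕ, TendstoLocallyUniformlyOn (fun k : ℕ => rescaledCorrelator (criticalCorr 3) rhoPin n (((2:ℝ) ^ k)⁻¹)) (S n) atTop (NonCoincident 3 n)) → (∀ n : ℕ, ContinuousOn (S n) (NonCoincident 3 n)) → (∀ n : ℕ, ∀ x ∈ NonCoincident 3 n, Tendsto (fun k : ℕ => rescaledCorrelator (criticalCorr 3) rhoPin n (((3:ℝ) ^ k)⁻¹) x) atTop (𝓝 (S' n x))) → ∀ (n : ℕ), ∀ x ∈ NonCoincident 3 n, S n x = (S 2 (![0, EuclideanSpace.single 0 3] : Fin 2 → EuclideanSpace ℝ (Fin 3))) ^ (-(n:ℝ) / 2) * S n (fun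 i => (3:ℝ) • x i) := by
  intro S S' hdy hcont htri n x hx
  have h1 : S 2 cfg0[(1:ℝ)] = 1 := dyadicLimit_cfg01 hdy
  have hA32 : 0 < S 2 cfg0[(3/2:ℝ)] := dyadicLimit_cfg0_pos hdy (s := 3/2) (by norm_num) (by norm_num)
  have hA2 : 0 < S 2 cfg0[(2:ℝ)] := dyadicLimit_cfg0_two_pos hdy
  -- `s = 1`: the common limit is forced, `S' = S` off the diagonals
  have hSS' : ∀ (m : ℕ), ∀ y ∈ NonCoincident 3 m, S' m y = S m y := by
    intro m y hy
    have h := triadicLimit_eq hdy hcont htri one_pos (by rw [h1]; exact one_ne_zero) m hy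
    rw [h1, Real.one_rpow, one_mul] at h
    simpa only [one_smul] using h
  -- `s = 3/2` at `x`
  have e1 : S n x = (S 2 cfg0[(3/2:ℝ)]) ^ (-(n:ℝ) / 2) * S n (fun i => (3/2:ℝ) • x i) := by
    rw [← hSS' n x hx]
    exact triadicLimit_eq hdy hcont htri (by norm_num) hA32.ne' n hx
  -- `s = 2` at `(3/2)·x`
  have hx' : (fun i => (3/2:ℝ) • x i) ∈ NonCoincident 3 n := smul_mem_nonCoincident (by norm_num) hx
  have e2 : S n (fun i => (3/2:ℝ) • x i) =
      (S 2 cfg0[(2:ℝ)]) ^ (-(n:ℝ) / 2) * S n (fun i => (3:ℝ) • x i) := by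
    have h := triadicLimit_eq hdy hcont htri two_pos hA2.ne' n hx'
    have e : (fun i => (3:ℝ) • x i) = fun i => (2:ℝ) • ((3/2:ℝ) • x i) := by
      funext i
      rw [smul_smul]
      norm_num
    rw [← hSS' n _ hx', h, e]
  -- multiplicativity on the axis: `S₂(0,3e₀) = S₂(0,(3/2)e₀) · S₂(0,2e₀)`
  have e3 : S 2 cfg0[(3:ℝ)] = S 2 cfg0[(3/2:ℝ)] * S 2 cfg0[(2:ℝ)] := by
    have h := triadicLimit_eq hdy hcont htri (by norm_num : (0:ℝ) < 3/2) hA32.ne' 2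
      (cfg0_mem two_ne_zero)
    rw [hSS' 2 _ (cfg0_mem two_ne_zero), cfg0_smul, show (3/2:ℝ) * 2 = 3 by norm_num,
      show (-((2:ℕ):ℝ) / 2) = -1 by norm_num, Real.rpow_neg_one] at h
    rw [h, ← mul_assoc, mul_inv_cancel₀ hA32.ne', one_mul]
  -- assemble
  calc S n x = (S 2 cfg0[(3/2:ℝ)]) ^ (-(n:ℝ) / 2) * S n (fun i => (3/2:ℝ) • x i) := e1
    _ = (S 2 cfg0[(3/2:ℝ)]) ^ (-(n:ℝ) / 2) *
          ((S 2 cfg0[(2:ℝ)]) ^ (-(n:ℝ) / 2) * S n (fun i => (3:ℝ) • x i)) := by rw [e2]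
    _ = (S 2 cfg0[(3/2:ℝ)] * S 2 cfg0[(2:ℝ)]) ^ (-(n:ℝ) / 2) * S n (fun i => (3:ℝ) • x i) := by
          rw [Real.mul_rpow hA32.le hA2.le, mul_assoc]
    _ = (S 2 cfg0[(3:ℝ)]) ^ (-(n:ℝ) / 2) * S n (fun i => (3:ℝ) • x i) := by rw [e3]

end Summit.CriticalPhenomena.Ising3DConformalLimit.Cruxes.ExistsScaleCovariantLimit.TwoHierarchies

end
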